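import Mathlib.InformationTheory.Hamming
import Literature.Barriers.PneNP.LowDegreeCounterexamples
import HarnessLib

/-!
# Barrier catalogue `PneNP`, Holmgren–Wein 2021 Thm. 2: the noise operator resamples few coordinates

Second ingredient (after `Literature/InformationTheory/Coding/HammingBall.lean`) of the proof of
the barrier fact `Literature.Barriers.PneNP.LowDegreeCounterexamples`
(`Literature/Barriers/PneNP/LowDegreeCounterexamples.lean`; J. Holmgren, A. S. Wein,
*Counterexamples to the low-degree conjecture*, ITCS 2021, Thm. 2 = LIPIcs Thm. 7): the step
"if `c'` is drawn from `T_δ μ` then `c'` is separated from some codeword `c` by at most `2δn`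
errors (w.h.p.)" (§5.2, arXiv PDF p. 9 / LIPIcs p. 75:8), i.e. "at most `2δn` coordinates get
resampled (w.h.p.)". We prove it for the tree's noise operator `noiseOp δ μ` (resampling set drawn
from the product law `Literature.Computability.Complexity.subsetPMF`, Def. 2) in the following
exponential-moment form (Markov's inequality applied to `2^{|T|}`, whose mean under the product
law with inclusion probability `q` is `(1+q)^n` by the binomial theorem), which avoids variances:

* `subsetPMF_toOuterMeasure_le` : `P(|T| ≥ k) ≤ (1+q)^n / 2^k`, `q = clampENNReal p`;
* `le_noiseOp_toOuterMeasure` : if a set `A ⊆ {0,1}^n` contains every string within Hamming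
  distance `r` of the support of `μ`, then `(T_δ μ)(A) ≥ 1 - (1+q)^n / 2^{r+1}` — the output of
  `T_δ` differs from the sample `x ∼ μ` only inside the resampling set `T`.

Theorems only (no new definitions); PMF bookkeeping through Mathlib's
`PMF.toOuterMeasure_bind_apply` / `toOuterMeasure_map_apply` / `toOuterMeasure_apply`.

## Audit note (barrier audit, 2026-08-17): the noise step along the noise-rate axis

* **Every rate, not only small ones.** The exponential-moment tail is as strong as the paper's
  "at most `2δn` coordinates (w.h.p.)" for EVERY `δ ∈ (0,1]`: at `k = ⌈2δn⌉`,
  `(1+δ)^n / 2^k ≤ exp(n (ln(1+δ) − 2δ ln 2)) ≤ exp(−(2 ln 2 − 1) δ n) ≤ exp(−0.386 δ n)`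
  (`ln(1+δ) ≤ δ`), i.e. the condition `(1+δ) < 2^θ` in `subsetPMF_toOuterMeasure_le` holds at
  `θ = 2δ` for all `δ > 0` (`one_add_lt_two_rpow_two_mul` below: `1 + δ < 2^{2δ}`). Both bounds
  are monotone in `δ`, so whatever a decoder test achieves at one rate it achieves at every smaller
  rate (in print: re-noising, `T_{δ'} ∘ T_δ = T_{1−(1−δ)(1−δ')}` and `T_{δ'} ν = ν`); the rates
  refuted by a Holmgren–Wein-type construction always form an initial segment `(0, δ*]`.
* **What caps `δ*` is the decoder, not this file**: the `≈ δn` resampled coordinates (`≈ δn/2`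
  actual bit flips) must stay inside the unique-decoding radius, whence
  `δ = min{1/(16e), ζ/8} < 1/8` in print [cite: HolmgrenWein2021, §5.2 (LIPIcs p. 75:8)] and
  `δ = 1/512` at radius `⌊n/128⌋` in `LowDegreeCounterexamplesProofs.lean`. Conjecture 1 and the
  technique class `LowDegreeTransfer` demand indistinguishability for EVERY `δ > 0` (the noise is
  "a small amount of additional noise ... to rule out non-robust algorithms such as Gaussian
  elimination" [cite: KuniskyWeinBandeira2019, §4.2.4]), so one small rate refutes them, and the
  later Boolean counterexamples are likewise proved at one small rate ("small enough `ε`"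
  [cite: BuhaiEtAl2025, Thm. 2.1 (arXiv p. 9)]; `ε_r := ε` with `ε` "so small that `aλ < 1/2`"
  [cite: Mao2026, Lemma 3.5 and proof of Thm. 1.2 (arXiv p. 25)]).
* **Heavy noise is an unprinted corner, not a documented evasion.** No printed statement refutes
  the per-rate transfer principle at a FIXED large rate `δ₀` (beyond every unique-decoding
  radius), but for non-symmetric Boolean strings it should be expected to fail at every `δ₀ < 1`
  (audit sketch — not in print, not formalised, recorded so that "demand heavy-noise robustness" is
  not mistaken for an evasion at `k = 1`): replace the uniquely decodable codes by the concatenation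
  of an outer Reed–Solomon code over `𝔽_{2^k}` (length `n^{1−c}`) with an inner low-rate
  Reed–Muller code `RM(m, ⌊a√m⌋)`, `2^m = n^c`, `k = dim RM`, which is decodable in polynomial
  time from a `p`-fraction of RANDOM errors with probability `1 − o(1)` for every fixed `p < 1/2`
  once `a = a(p)` is small [cite: SaptharishiShpilkaVolk2016, Thm. 1 (arXiv p. 4) and Cor. 13
  (arXiv p. 9)]; inner blocks fail independently with probability `o(1)` and the outer code
  absorbs them (unique decoding from `< (1−R)/2` symbol errors), the test "decode, accept iff the
  codeword found is within `(p+η)n`" rejects the null because `dim C = o(n)` (union bound), and the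
  dual distance of the concatenated code is `min(2^{⌊a√m⌋+1}, k_out + 1) = 2^{Θ(√log n)}` (a
  dual word is either blockwise in `RM^⊥ = RM(m, m − ⌊a√m⌋ − 1)` or meets `> k_out` blocks, by
  the MDS property of the outer code) — superpolylogarithmic, so Conjecture 1's
  `(log n)^{1+Ω(1)}`-wise independence is met at every noise rate, though Thm. 2's `Ω(n)`-wise
  independence is not. Open as far as this audit could determine: heavy noise together with
  `n^{Ω(1)}`-wise independence, and heavy noise for the `Sₙ`-symmetric graph counterexamples of
  [cite: BuhaiEtAl2025, Thm. 2.1] / [cite: Mao2026, Thm. 1.2].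

## References

* J. Holmgren, A. S. Wein, *Counterexamples to the low-degree conjecture*, ITCS 2021 (LIPIcs
  185:75) = arXiv:2004.08454, Def. 2 (noise operator; arXiv p. 5 / LIPIcs Def. 3) and §5.2,
  proof of Thm. 2 (arXiv p. 9 / LIPIcs Thm. 7, p. 75:8). Held
  (`lit read doi-10-4230-lipics-itcs-2021-75 --pages 4,8`).
* [KuniskyWeinBandeira2019] D. Kunisky, A. S. Wein, A. S. Bandeira, *Notes on computational
  hardness of hypothesis testing*, arXiv:1907.11636, §4.2.4 (the role of the noise). Held.
* [BuhaiEtAl2025] arXiv:2505.17360, Thm. 2.1 (arXiv p. 9); [Mao2026] arXiv:2607.20318, Thm. 1.2,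
  Lemma 3.5 (arXiv pp. 4–5, 25) — held; see `LowDegreeCounterexamples.lean` for the entries.
* [SaptharishiShpilkaVolk2016] R. Saptharishi, A. Shpilka, B. L. Volk, *Efficiently decoding
  Reed–Muller codes from random errors*, STOC 2016 = arXiv:1503.09092, Thm. 1 (arXiv p. 4),
  Cor. 13 (arXiv p. 9). Held (`lit read arxiv:1503.09092`).
-/

noncomputable section

namespace Literature.Barriers.PneNP

open scoped ENNReal
open Finset Literature.Computability.Complexity

variable {ι : Type} [Fintype ι] [DecidableEq ι]

/-! ### Complements under a `PMF`'s outer measure -/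

omit [Fintype ι] [DecidableEq ι] in
/-- A `PMF` gives complementary sets complementary masses: `p(s) + p(sᶜ) = 1`. [folklore] -/
theorem toOuterMeasure_add_compl {α : Type} (p : PMF α) (s : Set α) :
    p.toOuterMeasure s + p.toOuterMeasure sᶜ = 1 := by
  rw [PMF.toOuterMeasure_apply, PMF.toOuterMeasure_apply, ← ENNReal.tsum_add, ← p.tsum_coe]
  refine tsum_congr fun x => ?_
  by_cases hx : x ∈ s
  · rw [Set.indicator_of_mem hx, Set.indicator_of_notMem (show x ∉ sᶜ from fun h => h hx), add_zero]
  · rw [Set.indicator_of_notMem hx, Set.indicator_of_mem (show x ∈ sᶜ from hx), zero_add]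

omit [Fintype ι] [DecidableEq ι] in
/-- Hence `p(s) = 1 - p(sᶜ)`; in particular every set has mass `≤ 1`, for which the tree's term is
`le_of_le_of_eq le_self_add (toOuterMeasure_add_compl p s)` (the former named copy
`toOuterMeasure_apply_le_one'` duplicated a landed declaration and was removed, audit 2026-08-17).
[folklore] -/
theorem toOuterMeasure_eq_one_sub_compl {α : Type} (p : PMF α) (s : Set α) :
    p.toOuterMeasure s = 1 - p.toOuterMeasure sᶜ :=
  ENNReal.eq_sub_of_add_eq
    ((le_of_le_of_eq le_self_add (toOuterMeasure_add_compl p sᶜ)).trans_lt ENNReal.one_lt_top).ne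
    (toOuterMeasure_add_compl p s)

/-! ### The resampling set is small: an exponential-moment tail bound for the product law -/

omit [DecidableEq ι] in
/-- The product law on subsets, pointwise: `P(T) = q^{|T|} (1-q)^{n-|T|}`, `q = clampENNReal p`.
[folklore] -/
theorem subsetPMF_apply (p : ℝ) (T : Finset ι) :
    subsetPMF ι p T = clampENNReal p ^ T.card * (1 - clampENNReal p) ^ (Fintype.card ι - T.card) :=
  PMF.ofFintype_apply _ T

omit [DecidableEq ι] in
/-- **Exponential moment of the subset size**: `E[2^{|T|}] = (1+q)^n` under the product law with
inclusion probability `q` (binomial theorem). [folklore] -/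
theorem sum_subsetPMF_mul_two_pow (p : ℝ) :
    ∑ T : Finset ι, subsetPMF ι p T * 2 ^ T.card = (1 + clampENNReal p) ^ Fintype.card ι := by
  set q := clampENNReal p with hq
  have hq1 : q ≤ 1 := clampENNReal_le_one p
  calc ∑ T : Finset ι, subsetPMF ι p T * 2 ^ T.card
      = ∑ T : Finset ι, (2 * q) ^ T.card * (1 - q) ^ (Fintype.card ι - T.card) := by
        refine sum_congr rfl fun T _ => ?_
        rw [subsetPMF_apply, mul_pow]
        ring
    _ = (2 * q + (1 - q)) ^ Fintype.card ι := Fintype.sum_pow_mul_eq_add_pow ι _ _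
    _ = (1 + q) ^ Fintype.card ι := by
        rw [two_mul, add_assoc, add_tsub_cancel_of_le hq1, add_comm]

omit [DecidableEq ι] in
/-- **Tail bound for the size of the resampling set** (Markov on `2^{|T|}`):
`P(|T| ≥ k) ≤ (1+q)^n / 2^k`. For `q = δ` small and `k = θn` with `(1+δ) < 2^θ` this is
exponentially small — the formal content of "at most `2δn` coordinates get resampled (w.h.p.)".
[cite: HolmgrenWein2021, §5.2, proof of Thm. 2 (arXiv p. 9; LIPIcs p. 75:8)] -/
theorem subsetPMF_toOuterMeasure_le (p : ℝ) (k : ℕ) :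
    (subsetPMF ι p).toOuterMeasure {T | k ≤ T.card} ≤
      (1 + clampENNReal p) ^ Fintype.card ι / 2 ^ k := by
  have h2k : (2 : ℝ≥0∞) ^ k ≠ 0 := pow_ne_zero _ two_ne_zero
  have h2k' : (2 : ℝ≥0∞) ^ k ≠ ⊤ := ENNReal.pow_ne_top ENNReal.ofNat_ne_top
  rw [PMF.toOuterMeasure_apply_fintype, ← sum_subsetPMF_mul_two_pow p, ENNReal.div_eq_inv_mul,
    mul_sum]
  refine sum_le_sum fun T _ => ?_
  by_cases hT : k ≤ T.card
  · rw [Set.indicator_of_mem (show T ∈ {T : Finset ι | k ≤ T.card} from hT)]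
    calc subsetPMF ι p T = (2 ^ k)⁻¹ * (subsetPMF ι p T * 2 ^ k) := by
          rw [mul_comm (subsetPMF ι p T), ← mul_assoc, ENNReal.inv_mul_cancel h2k h2k', one_mul]
      _ ≤ (2 ^ k)⁻¹ * (subsetPMF ι p T * 2 ^ T.card) :=
          mul_le_mul_right (mul_le_mul_right (pow_le_pow_right₀ one_le_two hT) _) _
  · rw [Set.indicator_of_notMem (show T ∉ {T : Finset ι | k ≤ T.card} from hT)]
    exact zero_le

omit [Fintype ι] [DecidableEq ι] in
/-- **The tail bound reaches the paper's threshold `2δn` at every rate**: the base of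
`(1+δ)^n / 2^{2δn} = ((1+δ)/2^{2δ})^n` is `< 1` for ALL `δ > 0`, since `1 + δ < 2^{2δ} = 4^δ`
(tangent line of the convex `δ ↦ 4^δ` at `0`: `4^δ ≥ 1 + δ ln 4 > 1 + δ` as `ln 4 > 1`); so
"at most `2δn` coordinates get resampled (w.h.p.)" follows from `subsetPMF_toOuterMeasure_le` for
every `δ ∈ (0,1]`, not only for small `δ` (audit note in the module docstring). [folklore] -/
theorem one_add_lt_two_rpow_two_mul {δ : ℝ} (hδ : 0 < δ) : 1 + δ < (2 : ℝ) ^ (2 * δ) := by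
  have hlog : (1 : ℝ) < 2 * Real.log 2 := by
    have := Real.log_two_gt_d9
    linarith
  calc 1 + δ < 2 * Real.log 2 * δ + 1 := by nlinarith
    _ ≤ Real.exp (2 * Real.log 2 * δ) := Real.add_one_le_exp _
    _ = (2 : ℝ) ^ (2 * δ) := by
        rw [Real.rpow_def_of_pos two_pos]
        ring_nf

/-! ### The noise operator moves a sample by at most `|T|` -/

omit [Fintype ι] in
/-- The output `z` of `T_δ` (take `y` on `T`, `x` off `T`) differs from `x` only inside `T`:
`Δ(z, x) ≤ |T|`. [cite: HolmgrenWein2021, Def. 2 (arXiv p. 5; LIPIcs Def. 3)] -/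
theorem hammingDist_merge_le [Fintype ι] (x y : ι → Bool) (T : Finset ι) :
    hammingDist (fun i => if i ∈ T then y i else x i) x ≤ T.card := by
  refine card_le_card fun i hi => ?_
  by_contra hiT
  simp [hiT] at hi

/-- **`T_δ μ` stays near the support of `μ` with high probability**: if `A` contains every
string within Hamming distance `r` of the support of `μ`, then
`(T_δ μ)(A) ≥ 1 - (1+q)^n / 2^{r+1}` (`q = clampENNReal δ`), because the output differs from the
sample `x ∼ μ` only on the resampling set `T`, and `|T| ≤ r` except with the tail probability of
`subsetPMF_toOuterMeasure_le`. In Holmgren–Wein's proof `A` is the acceptance set of the decoder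
test and `r = 2δn ≤ ζn/4`.
[cite: HolmgrenWein2021, §5.2, proof of Thm. 2 (arXiv p. 9; LIPIcs p. 75:8)] -/
theorem le_noiseOp_toOuterMeasure (δ : ℝ) (μ : PMF (ι → Bool)) (A : Set (ι → Bool)) (r : ℕ)
    (hA : ∀ x ∈ μ.support, ∀ z : ι → Bool, hammingDist z x ≤ r → z ∈ A) :
    1 - (1 + clampENNReal δ) ^ Fintype.card ι / 2 ^ (r + 1) ≤ (noiseOp δ μ).toOuterMeasure A := by
  classical
  set tail : ℝ≥0∞ := (1 + clampENNReal δ) ^ Fintype.card ι / 2 ^ (r + 1) with htail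
  -- the inner law, for a sample `x` in the support, lands in `A` unless `|T| > r`
  have hinner : ∀ x ∈ μ.support, 1 - tail ≤
      ((subsetPMF ι δ).bind fun T => (PMF.uniformOfFintype (ι → Bool)).map
        fun y i => if i ∈ T then y i else x i).toOuterMeasure A := by
    intro x hx
    rw [PMF.toOuterMeasure_bind_apply]
    have hgood : ∀ T : Finset ι, T.card ≤ r →
        ((PMF.uniformOfFintype (ι → Bool)).map fun y i => if i ∈ T then y i else x i).toOuterMeasure
          A = 1 := by
      intro T hT
      rw [PMF.toOuterMeasure_map_apply, PMF.toOuterMeasure_apply_eq_one_iff]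
      intro y _
      exact hA x hx _ ((hammingDist_merge_le x y T).trans hT)
    calc 1 - tail ≤ 1 - (subsetPMF ι δ).toOuterMeasure {T | r + 1 ≤ T.card} :=
          tsub_le_tsub_left (subsetPMF_toOuterMeasure_le δ (r + 1)) 1
      _ = (subsetPMF ι δ).toOuterMeasure {T | T.card ≤ r} := by
          have hcompl : {T : Finset ι | T.card ≤ r}ᶜ = {T | r + 1 ≤ T.card} := by
            ext T
            simp only [Set.mem_compl_iff, Set.mem_setOf_eq, not_le, Nat.lt_iff_add_one_le]
          rw [toOuterMeasure_eq_one_sub_compl (subsetPMF ι δ) {T | T.card ≤ r}, hcompl]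
      _ = ∑' T, {T : Finset ι | T.card ≤ r}.indicator (subsetPMF ι δ) T :=
          PMF.toOuterMeasure_apply _ _
      _ ≤ ∑' T, subsetPMF ι δ T * ((PMF.uniformOfFintype (ι → Bool)).map
            fun y i => if i ∈ T then y i else x i).toOuterMeasure A := by
          refine ENNReal.tsum_le_tsum fun T => ?_
          by_cases hT : T.card ≤ r
          · rw [Set.indicator_of_mem (show T ∈ {T : Finset ι | T.card ≤ r} from hT), hgood T hT,
              mul_one]
          · rw [Set.indicator_of_notMem (show T ∉ {T : Finset ι | T.card ≤ r} from hT)]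
            exact zero_le
  -- average over `x ∼ μ`
  calc 1 - tail = ∑' x, μ x * (1 - tail) := by rw [ENNReal.tsum_mul_right, μ.tsum_coe, one_mul]
    _ ≤ ∑' x, μ x * ((subsetPMF ι δ).bind fun T => (PMF.uniformOfFintype (ι → Bool)).map
          fun y i => if i ∈ T then y i else x i).toOuterMeasure A := by
        refine ENNReal.tsum_le_tsum fun x => ?_
        by_cases hx : x ∈ μ.support
        · exact mul_le_mul_right (hinner x hx) _
        · rw [(PMF.apply_eq_zero_iff μ x).2 hx, zero_mul, zero_mul]
    _ = (noiseOp δ μ).toOuterMeasure A := by rw [noiseOp, PMF.toOuterMeasure_bind_apply]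

end Literature.Barriers.PneNP

end
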